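import Mathlib.Analysis.SpecialFunctions.Log.Basic
import Literature.MathematicalPhysics.QuantumLattice.QuasiLocalAlgebra
import Literature.MathematicalPhysics.QuantumLattice.DuhamelTwoPoint
import HarnessLib

/-!
# Energy–entropy balance (EEB) inequalities: the differential KMS condition and its validity for finite Gibbs states

Topic `Literature/MathematicalPhysics/QuantumLattice` (thermal toolkit; companion of
`Literature/Analysis/FunctionSpaces/KMSStates.lean`, which has the STRIP form `State.IsKMSState ω τ β`
of the KMS condition, and of `QuasiLocalAlgebra.lean`, which has the generator form
`State.IsGroundState ω τ` of the ground-state condition `-i ω(a⋆ δa) ≥ 0`).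

The **energy–entropy balance inequalities** (Araki–Sewell 1977, "local thermodynamical stability";
Bratteli–Robinson II Thm. 5.3.15 "auto-correlation lower bounds"; Araki–Moriya 2003 Def. 6.3
"differential `(δ, β)`-KMS condition"; Fawzi–Fawzi–Scalet 2024 Thm. 3.1 "EEB") say that a state `ω`
of a C⋆-dynamical system `(A, τ)` with generator `δ` is a `(τ, β)`-KMS state iff for every `a` in
the domain of `δ`

  `(C-1)`  `ω(a⋆ δa)` is purely imaginary, and
  `(C-2)`  `ω(a⋆a) · log (ω(a⋆a) / ω(aa⋆)) ≤ -iβ · ω(a⋆ δa)`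

(with `x log(x/y) := 0` for `x = 0` and `:= +∞` for `x > 0 = y`). For a lattice Hamiltonian,
`δa = i[H, a]` on local `a` and `(C-2)` reads `ω(a⋆a) log(ω(a⋆a)/ω(aa⋆)) ≤ β ω(a⋆[H,a])`
[cite: FawziFawziScalet2024, arXiv §3.1 Thm 3.1]; these convex constraints in the LOCAL data of `ω`
are the rows of the certified thermal SDP relaxations of Fawzi–Fawzi–Scalet (ibid. §3.2 (7)–(8)).

Contents (everything PROVED; one definition, no named facts):

* `Literature.MathematicalPhysics.QuantumLattice.State.IsDKMSState ω τ β` — the differential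
  `(τ, β)`-KMS condition `(C-1) ∧ (C-2)` of Araki–Moriya Def. 6.3, spelled exactly like the accepted
  `State.IsGroundState ω τ` ("`a ∈ D(δ)` with `δa`" = "`t ↦ τ_t(a)` has derivative `δa` at `0`"),
  the `+∞`-convention of `(C-2)` encoded as the clause `0 < ω(a⋆a) → 0 < ω(aa⋆)`; API: the three
  projections, the tangent (linear) consequences `θ·ω(a⋆a) − e^{θ−1}·ω(aa⋆) ≤ −iβ ω(a⋆δa)` for
  every real `θ` (`State.IsDKMSState.tangent_le`). (Sanity check, kept in the author's scratch
  file: for the TRIVIAL dynamics `τ_t = id` the predicate holds at every `β` iff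
  `ω(a⋆a) = ω(aa⋆)` for all `a`, i.e. iff `ω` is tracial — as it must.)
* The scalar convex-analysis core: `θ x − e^{θ−1} y ≤ x log(x/y)` for `x ≥ 0 < y` and all `θ`, with
  equality at `θ = 1 + log(x/y)` (`mul_sub_exp_mul_le_mul_log_div`, `tangent_eq_mul_log_div`), i.e.
  `x log(x/y) = sup_θ (θx − e^{θ−1}y)` (Legendre transform of `x ↦ x log x`).
* **Finite Gibbs states satisfy the EEB inequalities** (the finite-dimensional case of the
  implication KMS ⇒ EEB, Bratteli–Robinson II Thm. 5.3.15, for the Gibbs state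
  `⟨X⟩_β = tr(e^{-βH} X)/Z` = `Matrix.gibbsState β H` of a Hermitian matrix `H` and the dynamics
  `τ_t = Ad e^{itH}`, `δa = i[H,a]`), for EVERY matrix `a` and EVERY real `β`, in `namespace Matrix`
  (dot-notation extensions of Mathlib's `Matrix.IsHermitian`, as in `DuhamelTwoPoint.lean`):
  pair-sum (spectral) forms of `⟨a⋆a⟩`, `⟨aa⋆⟩`, `⟨a⋆[H,a]⟩` in an eigenbasis of `H`
  (`a' = U⋆aU`, `wᵢ = e^{-βEᵢ}`: `Z⟨a⋆a⟩ = Σᵢⱼ ‖a'ᵢⱼ‖² wⱼ`, `Z⟨aa⋆⟩ = Σᵢⱼ ‖a'ᵢⱼ‖² wᵢ`,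
  `Z⟨a⋆[H,a]⟩ = Σᵢⱼ ‖a'ᵢⱼ‖² wⱼ (Eᵢ − Eⱼ)`), whence: stationarity `⟨[H,a]⟩ = 0`
  (`gibbsState_commutator_eq_zero`), `(C-1)` `⟨a⋆[H,a]⟩ ∈ ℝ`
  (`IsHermitian.im_gibbsState_conjTranspose_mul_commutator`), faithfulness
  `⟨a⋆a⟩ = 0 ↔ a = 0 ↔ ⟨aa⋆⟩ = 0`, the **linear (tangent) EEB rows**
  `θ·⟨a⋆a⟩ − e^{θ−1}·⟨aa⋆⟩ ≤ β·⟨a⋆[H,a]⟩` for all real `θ` (`IsHermitian.eeb_tangent_le`, proved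
  PAIRWISE from `1 + s ≤ eˢ`: for the pair `(i,j)`, `θ wⱼ − e^{θ−1} wᵢ ≤ β(Eᵢ − Eⱼ) wⱼ`), the **exact
  EEB inequality** `⟨a⋆a⟩ log(⟨a⋆a⟩/⟨aa⋆⟩) ≤ β ⟨a⋆[H,a]⟩` (`IsHermitian.eeb_le`, the tangent row at
  the optimal `θ = 1 + log(⟨a⋆a⟩/⟨aa⋆⟩)`), the three clauses of Def. 6.3 verbatim for
  `δa = i[H,a]` (`IsHermitian.gibbsState_isDKMS_clauses`), and the CERTIFICATE ROW FORM with rational data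
  `(1+s)·⟨a⋆a⟩ − R·⟨aa⋆⟩ ≤ β·⟨a⋆[H,a]⟩` for any `R ≥ eˢ` (`IsHermitian.eeb_row_le_of_exp_le`,
  `IsHermitian.eeb_row_nonneg_of_exp_le`).

Consumers: the `T > 0` certificate family of the Hubbard cell (sr-mbsolver/hubbard-thermal):
the tangent rows are LINEAR in the moments `⟨a⋆a⟩, ⟨aa⋆⟩, ⟨a⋆[H,a]⟩` with data `(θ, e^{θ−1})`
replaceable by rationals `(θ, q)`, `q ≥ e^{θ−1}` (as `⟨aa⋆⟩ ≥ 0`), so they ride on the existing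
PSD-Gram + linear-rows + rational-dual certificate format unchanged; torus / canonical-sector and
thermodynamic-limit packagings of these rows are NOT here (they belong with the torus-limit states,
`TorusSectorGibbsMixture.lean` and its thermal companions), nor is the MATRIX EEB inequality
`D_op(A‖B) ⪯ βC` of [cite: FawziFawziScalet2024, arXiv §3.2 Thm 3.4] (operator relative entropy;
not needed for validity of scalar rows), nor the converse EEB ⇒ KMS / the equivalence dKMS ⇔ KMS
(Araki–Moriya Thm. 6.4 = Bratteli–Robinson II Thm. 5.3.15, a C⋆-dynamical statement whose proof
needs the analytic-element machinery of `KMSStatesProofs.lean`; deliberately not vendored as a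
named fact — no consumer takes it as a hypothesis today).

## References

* H. Araki, G. L. Sewell, *KMS conditions and local thermodynamical stability of quantum lattice
  systems*, Comm. Math. Phys. 52 (1977) 103–109 [ArakiSewell1977]; G. L. Sewell, part II,
  Comm. Math. Phys. 55 (1977) 53–61 [Sewell1977].
* O. Bratteli, D. W. Robinson, *Operator Algebras and Quantum Statistical Mechanics 2* (2nd ed.
  1997), Thm. 5.3.15 (auto-correlation lower bounds ⇔ KMS) [BratteliRobinsonII1997] (locator as
  quoted by Araki–Moriya 2003, §6.2, and Fawzi–Fawzi–Scalet 2024, §3.1).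
* H. Araki, H. Moriya, *Equilibrium statistical mechanics of fermion lattice systems*,
  Rev. Math. Phys. 15 (2003) 93–198, Def. 6.3 (dKMS), Thm. 6.4 (dKMS ⇔ KMS), Lemma 6.5
  [ArakiMoriya2003].
* H. Fawzi, O. Fawzi, S. O. Scalet, *Certified algorithms for equilibrium states of local quantum
  Hamiltonians*, Nat. Commun. 15 (2024) 7394 = arXiv:2311.18706, §3.1 Thm. 3.1, Rem. 3.2–3.3,
  §3.2 (7)–(8), Thm. 3.4 [FawziFawziScalet2024].

## Design notes

* Tree search (2026-08-26): `lean search 'dKMS|EnergyEntropyBalance|autoCorrelation'` — nothing;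
  `State.IsKMSState` (strip form) and `State.IsGroundState` (generator form) exist and are reused,
  not restated; `Matrix.gibbsState`, `gibbsState_hamiltonian_mul` (stationarity `⟨HA⟩ = ⟨AH⟩`),
  the eigenbasis pair sums (`Matrix.IsHermitian.gibbsWeight_eq`, `Matrix.trace_diagonal_mul_mul`,
  `Matrix.trace_unitary_conj_mul`, …) of `DuhamelTwoPoint.lean` are imported. Mathlib has no KMS /
  EEB notion.
* `State.IsDKMSState` is declared over `[CStarAlgebra A] [PartialOrder A]` exactly like
  `State.IsGroundState`; it is INTENDED for the C⋆-order (`[StarOrderedRing A]`), where states are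
  positive so that `ω(a⋆a), ω(aa⋆) ≥ 0` are real and Araki–Moriya's `S(x, y)` (defined for
  `x, y ≥ 0`) applies; all theorems about states carry `[StarOrderedRing A]`.
* Real parts: `(C-2)` is an inequality of reals, so it is written with `Complex.re`; `(C-1)` makes
  `-i ω(a⋆δa)` real. Lean's `Real.log 0 = 0`, `x / 0 = 0` make `x log(x/y)` equal to `0` whenever
  `x = 0` or `y = 0`; the printed conventions (`0` if `x = 0`, `+∞` if `x > 0 = y`) are restored by
  the separate clause `0 < x → 0 < y`, see the docstring of `State.IsDKMSState`.
* Sign conventions as in `QuasiLocalAlgebra.lean`: `τ_t(a) = e^{itH} a e^{-itH}`, `δa = i[H,a]`,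
  so `-i ω(a⋆ δa) = ω(a⋆[H,a])` with `[H,a] = Ha − aH`.
-/

noncomputable section

open scoped Matrix.Norms.L2Operator ComplexOrder
open Finset Complex

namespace Literature.MathematicalPhysics.QuantumLattice

/-! ### The scalar core: tangent lines of `x ↦ x log (x / y)` -/

/-- The elementary inequality behind every EEB tangent row: for `w ≥ 0` and reals `θ`, `L`,
`θ·w − e^{θ−1}·(w e^{−L}) ≤ L·w`; after division by `w` this is `1 + s ≤ eˢ` at
`s = θ − 1 − L`. [folklore] -/
private theorem mul_sub_exp_mul_mul_exp_neg_le {w : ℝ} (hw : 0 ≤ w) (θ L : ℝ) :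
    θ * w - Real.exp (θ - 1) * (w * Real.exp (-L)) ≤ L * w := by
  have h1 : θ - 1 - L + 1 ≤ Real.exp (θ - 1 - L) := Real.add_one_le_exp _
  have h2 : Real.exp (θ - 1 - L) = Real.exp (θ - 1) * Real.exp (-L) := by
    rw [← Real.exp_add]; ring_nf
  rw [h2] at h1
  have h3 := mul_le_mul_of_nonneg_right h1 hw
  nlinarith [h3]

/-- **Tangent-line (Fenchel–Young) inequality for `x log(x/y)`**: for `x ≥ 0`, `y > 0` and every
real `θ`, `θ x − e^{θ−1} y ≤ x log(x/y)`; equivalently `x log(x/y) = sup_θ (θ x − e^{θ−1} y)`, the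
Legendre transform of the convex function `x ↦ x log x − x` being `θ ↦ e^{θ}`. This is what makes
the (jointly convex) EEB constraint an intersection of LINEAR constraints in `(ω(a⋆a), ω(aa⋆))`.
It is Fenchel's inequality `xθ ≤ f(x) + f⋆(θ)` for the negative entropy `f(x) = x log x`, whose
conjugate is `f⋆(θ) = e^{θ−1}` (Boyd–Vandenberghe Example 3.21), applied to `x/y` and scaled by `y`.
[cite: BoydVandenberghe2004, §3.3.1 Example 3.21 (negative entropy) with §3.3.2 (Fenchel's inequality)] -/
theorem mul_sub_exp_mul_le_mul_log_div {x y : ℝ} (hx : 0 ≤ x) (hy : 0 < y) (θ : ℝ) :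
    θ * x - Real.exp (θ - 1) * y ≤ x * Real.log (x / y) := by
  rcases hx.eq_or_lt with h0 | hpos
  · rw [← h0]
    have : 0 ≤ Real.exp (θ - 1) * y := mul_nonneg (Real.exp_pos _).le hy.le
    simpa using this
  · have hL : x * Real.exp (-Real.log (x / y)) = y := by
      rw [Real.exp_neg, Real.exp_log (div_pos hpos hy)]
      field_simp
    have h := mul_sub_exp_mul_mul_exp_neg_le hx θ (Real.log (x / y))
    rw [hL] at h
    linarith [h]

/-- The tangent row at `θ = 1 + log(x/y)` is exact: `θ x − e^{θ−1} y = x log(x/y)` for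
`x, y > 0` (the supremum defining the conjugate of `x log x` is attained at `x = e^{θ−1}`,
Boyd–Vandenberghe Example 3.21). [cite: BoydVandenberghe2004, §3.3.1 Example 3.21] -/
theorem tangent_eq_mul_log_div {x y : ℝ} (hx : 0 < x) (hy : 0 < y) :
    (1 + Real.log (x / y)) * x - Real.exp (1 + Real.log (x / y) - 1) * y =
      x * Real.log (x / y) := by
  rw [add_sub_cancel_left, Real.exp_log (div_pos hx hy)]
  field_simp
  ring

/-! ### The differential KMS condition (energy–entropy balance) for a C⋆-dynamical system -/

section CStar

variable {A : Type*} [CStarAlgebra A] [PartialOrder A]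

/-- `ω` satisfies the **differential `(τ, β)`-KMS condition** (Araki–Moriya 2003 Def. 6.3; the
**energy–entropy balance inequalities** of Araki–Sewell 1977 / Fawzi–Fawzi–Scalet 2024 Thm. 3.1;
the auto-correlation lower bound of Bratteli–Robinson II Thm. 5.3.15): for every `a` in the domain
of the generator `δ` of `τ` — spelled, as in `State.IsGroundState`, "`t ↦ τ_t(a)` has a derivative
`δa` at `t = 0`" —
* `(C-1)` `ω(a⋆ δa)` is purely imaginary: `Re ω(a⋆ δa) = 0`;
* `(C-2)` `S(ω(aa⋆), ω(a⋆a)) ≤ −iβ ω(a⋆ δa)` where `S(x, y) = y log y − y log x` for `x, y > 0`,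
  `S(x, y) = +∞` for `x = 0 < y`, `S(x, 0) = 0`; i.e. `ω(a⋆a) log(ω(a⋆a)/ω(aa⋆)) ≤ −iβ ω(a⋆δa)`.
  With Lean's conventions `Real.log 0 = 0`, `x / 0 = 0` the real expression
  `Re ω(a⋆a) · log(Re ω(a⋆a) / Re ω(aa⋆))` is `0` whenever `Re ω(a⋆a) = 0` or `Re ω(aa⋆) = 0`, so
  the case `S = +∞` (which makes `(C-2)` FAIL) is carried by the separate clause
  `0 < Re ω(a⋆a) → 0 < Re ω(aa⋆)`.
For a lattice dynamics `δa = i[H,a]` on local `a`, `−i ω(a⋆ δa) = ω(a⋆[H,a])`. Intended for states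
of the C⋆-algebra (`[StarOrderedRing A]`, so that `ω(a⋆a), ω(aa⋆) ≥ 0`); equivalent there, for a
strongly continuous `τ` and `β > 0`, to `State.IsKMSState ω τ β` (Araki–Moriya Thm. 6.4 =
Bratteli–Robinson II Thm. 5.3.15 — NOT proved here); the formal `β = +∞` case of `(C-2)` is the
ground-state condition `State.IsGroundState` (Fawzi–Fawzi–Scalet Rem. after Thm. 3.1).
(Dot-namespaced on `Literature.MathematicalPhysics.QuantumLattice.State`.)
[cite: ArakiMoriya2003, Def 6.3] -/
def State.IsDKMSState (ω : State A) (τ : ℝ → (A ≃⋆ₐ[ℂ] A)) (β : ℝ) : Prop :=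
  ∀ (a δa : A), HasDerivAt (fun t : ℝ => τ t a) δa 0 →
    (ω (star a * δa)).re = 0 ∧
    (0 < (ω (star a * a)).re → 0 < (ω (a * star a)).re) ∧
    (ω (star a * a)).re * Real.log ((ω (star a * a)).re / (ω (a * star a)).re) ≤
      β * (-I * ω (star a * δa)).re

/-- `(C-1)` of a dKMS state: `Re ω(a⋆ δa) = 0` for `a ∈ D(δ)`. [cite: ArakiMoriya2003, Def 6.3 (C-1)] -/
theorem State.IsDKMSState.re_apply_star_mul_eq_zero {ω : State A} {τ : ℝ → (A ≃⋆ₐ[ℂ] A)} {β : ℝ}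
    (h : ω.IsDKMSState τ β) {a δa : A} (ha : HasDerivAt (fun t : ℝ => τ t a) δa 0) :
    (ω (star a * δa)).re = 0 :=
  (h a δa ha).1

/-- The `+∞`-clause of `(C-2)`: a dKMS state with `ω(a⋆a) > 0` has `ω(aa⋆) > 0` (`a ∈ D(δ)`).
[cite: ArakiMoriya2003, Def 6.3 (C-2)] -/
theorem State.IsDKMSState.re_pos_of_re_pos {ω : State A} {τ : ℝ → (A ≃⋆ₐ[ℂ] A)} {β : ℝ}
    (h : ω.IsDKMSState τ β) {a δa : A} (ha : HasDerivAt (fun t : ℝ => τ t a) δa 0)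
    (hpos : 0 < (ω (star a * a)).re) : 0 < (ω (a * star a)).re :=
  (h a δa ha).2.1 hpos

/-- `(C-2)` of a dKMS state, finite part: `ω(a⋆a) log(ω(a⋆a)/ω(aa⋆)) ≤ −iβ ω(a⋆ δa)`
(`a ∈ D(δ)`). [cite: ArakiMoriya2003, Def 6.3 (C-2)] -/
theorem State.IsDKMSState.mul_log_div_le {ω : State A} {τ : ℝ → (A ≃⋆ₐ[ℂ] A)} {β : ℝ}
    (h : ω.IsDKMSState τ β) {a δa : A} (ha : HasDerivAt (fun t : ℝ => τ t a) δa 0) :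
    (ω (star a * a)).re * Real.log ((ω (star a * a)).re / (ω (a * star a)).re) ≤
      β * (-I * ω (star a * δa)).re :=
  (h a δa ha).2.2

variable [StarOrderedRing A]

/-- For a state, `ω(a⋆a)` is a nonnegative real: `0 ≤ Re ω(a⋆a)` and `Im ω(a⋆a) = 0`
(positivity, Bratteli–Robinson I §2.3.2). [folklore] -/
private theorem State.re_apply_star_mul_self_nonneg (ω : State A) (a : A) :
    0 ≤ (ω (star a * a)).re ∧ (ω (star a * a)).im = 0 := by
  have h := ω.map_nonneg (star_mul_self_nonneg a)
  rw [Complex.nonneg_iff] at h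
  exact ⟨h.1, h.2.symm⟩

/-- For a state, `ω(aa⋆)` is a nonnegative real: `0 ≤ Re ω(aa⋆)` and `Im ω(aa⋆) = 0`.
[folklore] -/
private theorem State.re_apply_mul_star_self_nonneg (ω : State A) (a : A) :
    0 ≤ (ω (a * star a)).re ∧ (ω (a * star a)).im = 0 := by
  have h := ω.map_nonneg (mul_star_self_nonneg a)
  rw [Complex.nonneg_iff] at h
  exact ⟨h.1, h.2.symm⟩

/-- **The tangent (linear) EEB rows of a dKMS state**: for `a ∈ D(δ)` and every real `θ`,
`θ·ω(a⋆a) − e^{θ−1}·ω(aa⋆) ≤ −iβ·ω(a⋆ δa)` — the supporting lines of the convex constraint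
`(C-2)` (`mul_sub_exp_mul_le_mul_log_div`); for `ω(a⋆a) = 0` it is `−e^{θ−1} ω(aa⋆) ≤ 0 ≤ RHS`.
These are the linear constraints a moment relaxation imposes in place of `(C-2)`
(an outer approximation of the constraint set of Fawzi–Fawzi–Scalet's (7); our combination of
the cited `(C-2)` with the cited Fenchel inequality `mul_sub_exp_mul_le_mul_log_div`).
[cite: ArakiMoriya2003, Def 6.3 (C-2), tangent form via BoydVandenberghe2004 Example 3.21] -/
theorem State.IsDKMSState.tangent_le {ω : State A} {τ : ℝ → (A ≃⋆ₐ[ℂ] A)} {β : ℝ}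
    (h : ω.IsDKMSState τ β) {a δa : A} (ha : HasDerivAt (fun t : ℝ => τ t a) δa 0) (θ : ℝ) :
    θ * (ω (star a * a)).re - Real.exp (θ - 1) * (ω (a * star a)).re ≤
      β * (-I * ω (star a * δa)).re := by
  obtain ⟨-, h2, h3⟩ := h a δa ha
  have hx := (ω.re_apply_star_mul_self_nonneg a).1
  have hy := (ω.re_apply_mul_star_self_nonneg a).1
  rcases hx.eq_or_lt with hx0 | hxpos
  · -- `ω(a⋆a) = 0`: the row reads `-e^{θ-1} ω(aa⋆) ≤ RHS`, and `0 ≤ RHS` by `(C-2)`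
    rw [← hx0] at h3 ⊢
    have h0 : (0 : ℝ) ≤ β * (-I * ω (star a * δa)).re := by simpa using h3
    nlinarith [mul_nonneg (Real.exp_pos (θ - 1)).le hy]
  · exact (mul_sub_exp_mul_le_mul_log_div hx (h2 hxpos) θ).trans h3

end CStar

end Literature.MathematicalPhysics.QuantumLattice

/-! ### Finite Gibbs states satisfy the EEB inequalities -/

namespace Matrix

open Literature.MathematicalPhysics.QuantumLattice

variable {n : Type*} [Fintype n] [DecidableEq n]

omit [Fintype n] [DecidableEq n] in
/-- **The per-pair EEB inequality**: for an eigen-pair `(Eᵢ, Eⱼ)` of `H`, a weight `m ≥ 0` and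
Boltzmann factors `wₖ = e^{-βEₖ}`, `θ·(m wⱼ) − e^{θ−1}·(m wᵢ) ≤ β·(m wⱼ (Eᵢ − Eⱼ))` for every
real `θ` — `mul_sub_exp_mul_mul_exp_neg_le` with `L = β(Eᵢ − Eⱼ) = log(wⱼ/wᵢ)`. Summed over pairs
it is the tangent EEB row of the Gibbs state. [folklore] -/
private theorem eeb_pair_le (β θ Ei Ej m : ℝ) (hm : 0 ≤ m) :
    θ * (m * Real.exp (-(β * Ej))) - Real.exp (θ - 1) * (m * Real.exp (-(β * Ei))) ≤
      β * (m * Real.exp (-(β * Ej)) * (Ei - Ej)) := by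
  have hw : 0 ≤ m * Real.exp (-(β * Ej)) := mul_nonneg hm (Real.exp_pos _).le
  have h := mul_sub_exp_mul_mul_exp_neg_le hw θ (β * (Ei - Ej))
  have he : m * Real.exp (-(β * Ej)) * Real.exp (-(β * (Ei - Ej))) =
      m * Real.exp (-(β * Ei)) := by
    rw [mul_assoc, ← Real.exp_add]; ring_nf
  rw [he] at h
  calc θ * (m * Real.exp (-(β * Ej))) - Real.exp (θ - 1) * (m * Real.exp (-(β * Ei)))
      ≤ β * (Ei - Ej) * (m * Real.exp (-(β * Ej))) := h
    _ = β * (m * Real.exp (-(β * Ej)) * (Ei - Ej)) := by ring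

/-- **Stationarity of the Gibbs state in commutator form**: `⟨[H, a]⟩_β = ⟨Ha − aH⟩_β = 0` for
every matrix `a` (the linear KMS constraints `ω([H,a]) = 0` of Fawzi–Fawzi–Scalet Thm. 3.1; this
is `Matrix.gibbsState_hamiltonian_mul`, `⟨HA⟩ = ⟨AH⟩`, rewritten). (Dot-notation extension of
Mathlib's `Matrix`.) [cite: FawziFawziScalet2024, arXiv §3.1 Thm 3.1 (4)] -/
theorem gibbsState_commutator_eq_zero (β : ℝ) (H a : Matrix n n ℂ) :
    gibbsState β H (H * a - a * H) = 0 := by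
  rw [map_sub, gibbsState_hamiltonian_mul, sub_self]

omit [Fintype n] [DecidableEq n] in
/-- Rotating an adjoint: `U⋆ aᴴ U = (U⋆ a U)ᴴ`. [folklore] -/
private theorem star_mul_conjTranspose_mul [Fintype n] (U a : Matrix n n ℂ) :
    star U * aᴴ * U = (star U * a * U)ᴴ := by
  rw [conjTranspose_mul, conjTranspose_mul, star_eq_conjTranspose, conjTranspose_conjTranspose,
    Matrix.mul_assoc]

/-- A matrix vanishes iff its rotation `U⋆ a U` by a unitary `U` vanishes. [folklore] -/
private theorem star_mul_mul_eq_zero_iff {U : Matrix n n ℂ} (hU : U ∈ unitary (Matrix n n ℂ))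
    (a : Matrix n n ℂ) : star U * a * U = 0 ↔ a = 0 := by
  constructor
  · intro h
    have : a = U * (star U * a * U) * star U := by
      simp only [Matrix.mul_assoc]
      rw [Unitary.mul_star_self_of_mem hU, Matrix.mul_one, ← Matrix.mul_assoc,
        Unitary.mul_star_self_of_mem hU, Matrix.one_mul]
    rw [this, h, Matrix.mul_zero, Matrix.zero_mul]
  · rintro rfl
    rw [Matrix.mul_zero, Matrix.zero_mul]

section Spectral

variable {H : Matrix n n ℂ}

/-- **Pair-sum form of `⟨a⋆a⟩`**: `tr(e^{-βH} aᴴa) = Σᵢⱼ ‖a'ᵢⱼ‖² e^{-βEⱼ}` with `a' = U⋆aU` in an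
eigenbasis `H = U diag(E) U⋆` (any matrix `a`) — the scalar (`m = 1`) case of the
decomposition `A = Σₖ A⁽ᵏ⁾` over the spectrum `{Eᵢ − Eⱼ}` of `L = [H, ·]` in Fawzi–Fawzi–Scalet's
finite-dimensional proof of the matrix EEB inequality. (Dot-notation extension of Mathlib's
`Matrix.IsHermitian`.)
[cite: FawziFawziScalet2024, arXiv §3.2 proof of Thm 3.4 (finite-dimensional case: A = Σₖ A⁽ᵏ⁾, B = Σₖ e^{-βλₖ} A⁽ᵏ⁾, C = Σₖ λₖ A⁽ᵏ⁾ over the spectrum of L = [H,·])] -/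
theorem IsHermitian.trace_gibbsWeight_mul_conjTranspose_mul_self (hH : H.IsHermitian) (a : Matrix n n ℂ) (β : ℝ) :
    (gibbsWeight β H * (aᴴ * a)).trace =
      ∑ i, ∑ j, ((‖(star (hH.eigenvectorUnitary : Matrix n n ℂ) * a *
          (hH.eigenvectorUnitary : Matrix n n ℂ)) i j‖ ^ 2 *
            Real.exp (-(β * hH.eigenvalues j)) : ℝ) : ℂ) := by
  set U := (hH.eigenvectorUnitary : Matrix n n ℂ) with hU
  have hUm : U ∈ unitary (Matrix n n ℂ) := hH.eigenvectorUnitary.prop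
  set a' := star U * a * U with ha'
  rw [hH.gibbsWeight_eq β, ← hU, trace_unitary_conj_mul, star_unitary_mul_mul_mul hUm,
    star_mul_conjTranspose_mul, ← ha', ← Matrix.mul_assoc, trace_diagonal_mul_mul]
  conv_lhs => rw [Finset.sum_comm]
  refine sum_congr rfl fun i _ => sum_congr rfl fun j _ => ?_
  rw [conjTranspose_apply, mul_assoc, mul_comm (star (a' i j)) (a' i j), mul_star_eq_normSq_cast]
  push_cast
  ring

/-- **Pair-sum form of `⟨aa⋆⟩`**: `tr(e^{-βH} aaᴴ) = Σᵢⱼ ‖a'ᵢⱼ‖² e^{-βEᵢ}`, `a' = U⋆aU` (the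
`B = Σₖ e^{-βλₖ} A⁽ᵏ⁾` of Fawzi–Fawzi–Scalet's proof: `e^{-βEᵢ} = e^{-βEⱼ} e^{-β(Eᵢ−Eⱼ)}`).
[cite: FawziFawziScalet2024, arXiv §3.2 proof of Thm 3.4 (finite-dimensional case: A = Σₖ A⁽ᵏ⁾, B = Σₖ e^{-βλₖ} A⁽ᵏ⁾, C = Σₖ λₖ A⁽ᵏ⁾ over the spectrum of L = [H,·])] -/
theorem IsHermitian.trace_gibbsWeight_mul_self_mul_conjTranspose (hH : H.IsHermitian) (a : Matrix n n ℂ) (β : ℝ) :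
    (gibbsWeight β H * (a * aᴴ)).trace =
      ∑ i, ∑ j, ((‖(star (hH.eigenvectorUnitary : Matrix n n ℂ) * a *
          (hH.eigenvectorUnitary : Matrix n n ℂ)) i j‖ ^ 2 *
            Real.exp (-(β * hH.eigenvalues i)) : ℝ) : ℂ) := by
  set U := (hH.eigenvectorUnitary : Matrix n n ℂ) with hU
  have hUm : U ∈ unitary (Matrix n n ℂ) := hH.eigenvectorUnitary.prop
  set a' := star U * a * U with ha'
  rw [hH.gibbsWeight_eq β, ← hU, trace_unitary_conj_mul, star_unitary_mul_mul_mul hUm,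
    star_mul_conjTranspose_mul, ← ha', ← Matrix.mul_assoc, trace_diagonal_mul_mul]
  refine sum_congr rfl fun i _ => sum_congr rfl fun j _ => ?_
  rw [conjTranspose_apply, mul_assoc, mul_star_eq_normSq_cast]
  push_cast
  ring

/-- **Pair-sum form of `⟨a⋆[H,a]⟩`**: `tr(e^{-βH} aᴴ(Ha − aH)) = Σᵢⱼ ‖a'ᵢⱼ‖² e^{-βEⱼ} (Eᵢ − Eⱼ)`,
`a' = U⋆aU` (the `C = Σₖ λₖ A⁽ᵏ⁾` of Fawzi–Fawzi–Scalet's proof: `[H, ·]` is diagonal on the matrix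
units of an eigenbasis, with eigenvalues `Eᵢ − Eⱼ`).
[cite: FawziFawziScalet2024, arXiv §3.2 proof of Thm 3.4 (finite-dimensional case: A = Σₖ A⁽ᵏ⁾, B = Σₖ e^{-βλₖ} A⁽ᵏ⁾, C = Σₖ λₖ A⁽ᵏ⁾ over the spectrum of L = [H,·])] -/
theorem IsHermitian.trace_gibbsWeight_mul_conjTranspose_mul_commutator (hH : H.IsHermitian) (a : Matrix n n ℂ) (β : ℝ) :
    (gibbsWeight β H * (aᴴ * (H * a - a * H))).trace =
      ∑ i, ∑ j, ((‖(star (hH.eigenvectorUnitary : Matrix n n ℂ) * a *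
          (hH.eigenvectorUnitary : Matrix n n ℂ)) i j‖ ^ 2 *
            Real.exp (-(β * hH.eigenvalues j)) * (hH.eigenvalues i - hH.eigenvalues j) : ℝ) : ℂ) := by
  set U := (hH.eigenvectorUnitary : Matrix n n ℂ) with hU
  have hUm : U ∈ unitary (Matrix n n ℂ) := hH.eigenvectorUnitary.prop
  set a' := star U * a * U with ha'
  set E : n → ℂ := fun i => (hH.eigenvalues i : ℂ) with hE
  have hdiag : star U * H * U = diagonal E := by
    rw [hU, hE]; exact hH.star_mul_self_mul_eq_diagonal
  have hrot : star U * (H * a - a * H) * U = diagonal E * a' - a' * diagonal E := by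
    rw [Matrix.mul_sub, Matrix.sub_mul, star_unitary_mul_mul_mul hUm, star_unitary_mul_mul_mul hUm,
      hdiag]
  rw [hH.gibbsWeight_eq β, ← hU, trace_unitary_conj_mul, star_unitary_mul_mul_mul hUm,
    star_mul_conjTranspose_mul, hrot, ← ha', ← Matrix.mul_assoc, trace_diagonal_mul_mul]
  conv_lhs => rw [Finset.sum_comm]
  refine sum_congr rfl fun i _ => sum_congr rfl fun j _ => ?_
  rw [conjTranspose_apply, sub_apply, diagonal_mul, mul_diagonal, hE]
  have : (Real.exp (-(β * hH.eigenvalues j)) : ℂ) * star (a' i j) *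
      ((hH.eigenvalues i : ℂ) * a' i j - a' i j * (hH.eigenvalues j : ℂ)) =
        (Real.exp (-(β * hH.eigenvalues j)) : ℂ) * (a' i j * star (a' i j)) *
          ((hH.eigenvalues i : ℂ) - (hH.eigenvalues j : ℂ)) := by ring
  rw [this, mul_star_eq_normSq_cast]
  push_cast
  ring

/-- `Re⟨a⋆a⟩_β = Z⁻¹ Σᵢⱼ ‖a'ᵢⱼ‖² e^{-βEⱼ}` (real form of the pair sum).
[cite: FawziFawziScalet2024, arXiv §3.2 proof of Thm 3.4 (finite-dimensional case: A = Σₖ A⁽ᵏ⁾, B = Σₖ e^{-βλₖ} A⁽ᵏ⁾, C = Σₖ λₖ A⁽ᵏ⁾ over the spectrum of L = [H,·])] -/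
theorem IsHermitian.re_gibbsState_conjTranspose_mul_self (hH : H.IsHermitian) (a : Matrix n n ℂ) (β : ℝ) :
    (gibbsState β H (aᴴ * a)).re = (∑ i, Real.exp (-(β * hH.eigenvalues i)))⁻¹ *
      ∑ i, ∑ j, ‖(star (hH.eigenvectorUnitary : Matrix n n ℂ) * a *
          (hH.eigenvectorUnitary : Matrix n n ℂ)) i j‖ ^ 2 * Real.exp (-(β * hH.eigenvalues j)) := by
  rw [hH.re_gibbsState, hH.trace_gibbsWeight_mul_conjTranspose_mul_self]
  congr 1
  simp_rw [← Complex.ofReal_sum]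
  rw [Complex.ofReal_re]

/-- `Re⟨aa⋆⟩_β = Z⁻¹ Σᵢⱼ ‖a'ᵢⱼ‖² e^{-βEᵢ}` (real form of the pair sum).
[cite: FawziFawziScalet2024, arXiv §3.2 proof of Thm 3.4 (finite-dimensional case: A = Σₖ A⁽ᵏ⁾, B = Σₖ e^{-βλₖ} A⁽ᵏ⁾, C = Σₖ λₖ A⁽ᵏ⁾ over the spectrum of L = [H,·])] -/
theorem IsHermitian.re_gibbsState_self_mul_conjTranspose (hH : H.IsHermitian) (a : Matrix n n ℂ) (β : ℝ) :
    (gibbsState β H (a * aᴴ)).re = (∑ i, Real.exp (-(β * hH.eigenvalues i)))⁻¹ *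
      ∑ i, ∑ j, ‖(star (hH.eigenvectorUnitary : Matrix n n ℂ) * a *
          (hH.eigenvectorUnitary : Matrix n n ℂ)) i j‖ ^ 2 * Real.exp (-(β * hH.eigenvalues i)) := by
  rw [hH.re_gibbsState, hH.trace_gibbsWeight_mul_self_mul_conjTranspose]
  congr 1
  simp_rw [← Complex.ofReal_sum]
  rw [Complex.ofReal_re]

/-- `⟨a⋆[H,a]⟩_β = Z⁻¹ Σᵢⱼ ‖a'ᵢⱼ‖² e^{-βEⱼ}(Eᵢ − Eⱼ)` as a real cast (so it IS real: the matrix `C`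
of Fawzi–Fawzi–Scalet Thm. 3.4 is Hermitian).
[cite: FawziFawziScalet2024, arXiv §3.2 proof of Thm 3.4 (finite-dimensional case: A = Σₖ A⁽ᵏ⁾, B = Σₖ e^{-βλₖ} A⁽ᵏ⁾, C = Σₖ λₖ A⁽ᵏ⁾ over the spectrum of L = [H,·])] -/
theorem IsHermitian.gibbsState_conjTranspose_mul_commutator_eq_ofReal (hH : H.IsHermitian) (a : Matrix n n ℂ) (β : ℝ) :
    gibbsState β H (aᴴ * (H * a - a * H)) =
      (((∑ i, Real.exp (-(β * hH.eigenvalues i)))⁻¹ *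
        ∑ i, ∑ j, ‖(star (hH.eigenvectorUnitary : Matrix n n ℂ) * a *
          (hH.eigenvectorUnitary : Matrix n n ℂ)) i j‖ ^ 2 * Real.exp (-(β * hH.eigenvalues j)) *
            (hH.eigenvalues i - hH.eigenvalues j) : ℝ) : ℂ) := by
  rw [gibbsState_apply, hH.partitionFn_eq_ofReal,
    hH.trace_gibbsWeight_mul_conjTranspose_mul_commutator, ← Complex.ofReal_inv]
  simp_rw [← Complex.ofReal_sum]
  rw [← Complex.ofReal_mul]

/-- `Re⟨a⋆[H,a]⟩_β = Z⁻¹ Σᵢⱼ ‖a'ᵢⱼ‖² e^{-βEⱼ}(Eᵢ − Eⱼ)` (real form of the pair sum).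
[cite: FawziFawziScalet2024, arXiv §3.2 proof of Thm 3.4 (finite-dimensional case: A = Σₖ A⁽ᵏ⁾, B = Σₖ e^{-βλₖ} A⁽ᵏ⁾, C = Σₖ λₖ A⁽ᵏ⁾ over the spectrum of L = [H,·])] -/
theorem IsHermitian.re_gibbsState_conjTranspose_mul_commutator (hH : H.IsHermitian) (a : Matrix n n ℂ) (β : ℝ) :
    (gibbsState β H (aᴴ * (H * a - a * H))).re = (∑ i, Real.exp (-(β * hH.eigenvalues i)))⁻¹ *
      ∑ i, ∑ j, ‖(star (hH.eigenvectorUnitary : Matrix n n ℂ) * a *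
          (hH.eigenvectorUnitary : Matrix n n ℂ)) i j‖ ^ 2 * Real.exp (-(β * hH.eigenvalues j)) *
            (hH.eigenvalues i - hH.eigenvalues j) := by
  rw [hH.gibbsState_conjTranspose_mul_commutator_eq_ofReal, Complex.ofReal_re]

/-- **`(C-1)` for Gibbs states**: `⟨a⋆[H,a]⟩_β` is real for every matrix `a`, i.e. `⟨a⋆ δa⟩` with
`δa = i[H,a]` is purely imaginary (the matrix `C` of Fawzi–Fawzi–Scalet Thm. 3.4 is Hermitian).
[cite: ArakiMoriya2003, Def 6.3 (C-1)] -/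
theorem IsHermitian.im_gibbsState_conjTranspose_mul_commutator (hH : H.IsHermitian) (a : Matrix n n ℂ) (β : ℝ) :
    (gibbsState β H (aᴴ * (H * a - a * H))).im = 0 := by
  rw [hH.gibbsState_conjTranspose_mul_commutator_eq_ofReal, Complex.ofReal_im]

/-- **Faithfulness of the Gibbs state**: `Re⟨a⋆a⟩_β = 0 ↔ a = 0` (all Boltzmann weights are
positive: the density `e^{-βH}/Z` has trivial kernel).
[cite: DerezinskiGerard2022, §6.4.4 (a density-matrix state is faithful iff Ker γ = {0}; Gibbs density e^{-βH}/Tr e^{-βH})] -/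
theorem IsHermitian.re_gibbsState_conjTranspose_mul_self_eq_zero_iff (hH : H.IsHermitian) (a : Matrix n n ℂ) (β : ℝ) :
    (gibbsState β H (aᴴ * a)).re = 0 ↔ a = 0 := by
  have hUm : (hH.eigenvectorUnitary : Matrix n n ℂ) ∈ unitary (Matrix n n ℂ) :=
    hH.eigenvectorUnitary.prop
  rw [hH.re_gibbsState_conjTranspose_mul_self, ← star_mul_mul_eq_zero_iff hUm a]
  rcases isEmpty_or_nonempty n with hn | hn
  · simp only [Finset.univ_eq_empty, Finset.sum_empty, mul_zero, true_iff]
    ext i j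
    exact (IsEmpty.false i).elim
  have hZ : 0 < (∑ i, Real.exp (-(β * hH.eigenvalues i)))⁻¹ := inv_pos.mpr (hH.sum_exp_pos β)
  have hterm : ∀ i j, 0 ≤ ‖(star (hH.eigenvectorUnitary : Matrix n n ℂ) * a *
      (hH.eigenvectorUnitary : Matrix n n ℂ)) i j‖ ^ 2 * Real.exp (-(β * hH.eigenvalues j)) :=
    fun i j => mul_nonneg (sq_nonneg _) (Real.exp_pos _).le
  rw [mul_eq_zero, or_iff_right hZ.ne', Finset.sum_eq_zero_iff_of_nonneg fun i _ =>
    Finset.sum_nonneg fun j _ => hterm i j]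
  constructor
  · intro h
    ext i j
    have hi := (Finset.sum_eq_zero_iff_of_nonneg fun j _ => hterm i j).mp (h i (mem_univ i)) j
      (mem_univ j)
    rw [mul_eq_zero, or_iff_left (Real.exp_pos _).ne', sq_eq_zero_iff, norm_eq_zero] at hi
    exact hi
  · intro h i _
    refine Finset.sum_eq_zero fun j _ => ?_
    rw [h, zero_apply, norm_zero, zero_pow two_ne_zero, zero_mul]

/-- Faithfulness, second form: `Re⟨aa⋆⟩_β = 0 ↔ a = 0`.
[cite: DerezinskiGerard2022, §6.4.4 (a density-matrix state is faithful iff Ker γ = {0}; Gibbs density e^{-βH}/Tr e^{-βH})] -/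
theorem IsHermitian.re_gibbsState_self_mul_conjTranspose_eq_zero_iff (hH : H.IsHermitian) (a : Matrix n n ℂ) (β : ℝ) :
    (gibbsState β H (a * aᴴ)).re = 0 ↔ a = 0 := by
  have h := hH.re_gibbsState_conjTranspose_mul_self_eq_zero_iff aᴴ β
  rw [conjTranspose_conjTranspose] at h
  rw [h]
  exact conjTranspose_eq_zero

/-- `0 ≤ Re⟨a⋆a⟩_β` (`Matrix.gibbsState_nonneg_of_posSemidef`, real part). [folklore] -/
private theorem IsHermitian.re_gibbsState_conjTranspose_mul_self_nonneg (hH : H.IsHermitian) (a : Matrix n n ℂ) (β : ℝ) :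
    0 ≤ (gibbsState β H (aᴴ * a)).re :=
  (Complex.nonneg_iff.mp
    (gibbsState_nonneg_of_posSemidef β hH (posSemidef_conjTranspose_mul_self a))).1

/-- `0 ≤ Re⟨aa⋆⟩_β` (`Matrix.gibbsState_nonneg_of_posSemidef`, real part). [folklore] -/
private theorem IsHermitian.re_gibbsState_self_mul_conjTranspose_nonneg (hH : H.IsHermitian) (a : Matrix n n ℂ) (β : ℝ) :
    0 ≤ (gibbsState β H (a * aᴴ)).re :=
  (Complex.nonneg_iff.mp
    (gibbsState_nonneg_of_posSemidef β hH (posSemidef_self_mul_conjTranspose a))).1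

/-- **The tangent (linear) EEB rows of a finite Gibbs state**: for a Hermitian `H`, EVERY real
`β`, every matrix `a` and every real `θ`,
`θ·Re⟨aᴴa⟩_β − e^{θ−1}·Re⟨aaᴴ⟩_β ≤ β·Re⟨aᴴ(Ha − aH)⟩_β`.
Proof: in an eigenbasis all three moments are pair sums with the common weight `‖a'ᵢⱼ‖²`
(`re_gibbsState_conjTranspose_mul_self`, `…_self_mul_conjTranspose`, `…_conjTranspose_mul_commutator`)
and the inequality holds pair by pair (`Matrix.eeb_pair_le`, i.e. `1 + s ≤ eˢ`). These are the
linear outer approximations of the EEB constraint (8) of Fawzi–Fawzi–Scalet used as certificate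
rows; `e^{θ−1}` may be replaced by any `q ≥ e^{θ−1}` since `Re⟨aaᴴ⟩ ≥ 0`.
[cite: FawziFawziScalet2024, arXiv §3.1 Thm 3.1 (5) (finite Gibbs state, tangent form)] -/
theorem IsHermitian.eeb_tangent_le (hH : H.IsHermitian) (β θ : ℝ) (a : Matrix n n ℂ) :
    θ * (gibbsState β H (aᴴ * a)).re - Real.exp (θ - 1) * (gibbsState β H (a * aᴴ)).re ≤
      β * (gibbsState β H (aᴴ * (H * a - a * H))).re := by
  set U := (hH.eigenvectorUnitary : Matrix n n ℂ) with hU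
  set m : n → n → ℝ := fun i j => ‖(star U * a * U) i j‖ ^ 2 with hm
  set w : n → ℝ := fun i => Real.exp (-(β * hH.eigenvalues i)) with hw
  set E : n → ℝ := fun i => hH.eigenvalues i with hE
  have key : ∑ i, ∑ j, (θ * (m i j * w j) - Real.exp (θ - 1) * (m i j * w i)) ≤
      ∑ i, ∑ j, β * (m i j * w j * (E i - E j)) :=
    sum_le_sum fun i _ => sum_le_sum fun j _ =>
      eeb_pair_le β θ (E i) (E j) (m i j) (sq_nonneg _)
  have key2 : θ * (∑ i, ∑ j, m i j * w j) - Real.exp (θ - 1) * (∑ i, ∑ j, m i j * w i) ≤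
      β * ∑ i, ∑ j, m i j * w j * (E i - E j) := by
    have e1 : θ * (∑ i, ∑ j, m i j * w j) = ∑ i, ∑ j, θ * (m i j * w j) := by
      simp_rw [Finset.mul_sum]
    have e2 : Real.exp (θ - 1) * (∑ i, ∑ j, m i j * w i) =
        ∑ i, ∑ j, Real.exp (θ - 1) * (m i j * w i) := by
      simp_rw [Finset.mul_sum]
    have e3 : β * (∑ i, ∑ j, m i j * w j * (E i - E j)) =
        ∑ i, ∑ j, β * (m i j * w j * (E i - E j)) := by
      simp_rw [Finset.mul_sum]
    rw [e1, e2, e3, ← sum_sub_distrib]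
    simp_rw [← sum_sub_distrib]
    exact key
  have hZ : 0 ≤ (∑ i, w i)⁻¹ := inv_nonneg.mpr (sum_nonneg fun i _ => (Real.exp_pos _).le)
  rw [hH.re_gibbsState_conjTranspose_mul_self, hH.re_gibbsState_self_mul_conjTranspose,
    hH.re_gibbsState_conjTranspose_mul_commutator]
  have h := mul_le_mul_of_nonneg_left key2 hZ
  simp only [← hU, ← hE] at h ⊢
  nlinarith [h]

/-- **Finite Gibbs states satisfy the energy–entropy balance inequality** (Fawzi–Fawzi–Scalet
Thm. 3.1 (5) / Araki–Moriya `(C-2)` / Bratteli–Robinson II Thm. 5.3.15, finite-dimensional case of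
KMS ⇒ EEB): for a Hermitian matrix `H`, EVERY real `β` and EVERY matrix `a`,
`Re⟨aᴴa⟩_β · log(Re⟨aᴴa⟩_β / Re⟨aaᴴ⟩_β) ≤ β · Re⟨aᴴ(Ha − aH)⟩_β`,
where `⟨·⟩_β = tr(e^{-βH} ·)/Z` is `Matrix.gibbsState β H`. (For `a = 0` both sides vanish;
otherwise `Re⟨aᴴa⟩, Re⟨aaᴴ⟩ > 0` and this is the tangent row `eeb_tangent_le` at the optimal
`θ = 1 + log(Re⟨aᴴa⟩/Re⟨aaᴴ⟩)`.) [cite: FawziFawziScalet2024, arXiv §3.1 Thm 3.1 (5)] -/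
theorem IsHermitian.eeb_le (hH : H.IsHermitian) (β : ℝ) (a : Matrix n n ℂ) :
    (gibbsState β H (aᴴ * a)).re *
        Real.log ((gibbsState β H (aᴴ * a)).re / (gibbsState β H (a * aᴴ)).re) ≤
      β * (gibbsState β H (aᴴ * (H * a - a * H))).re := by
  by_cases ha : a = 0
  · subst ha
    simp
  · have hu : 0 < (gibbsState β H (aᴴ * a)).re :=
      lt_of_le_of_ne (hH.re_gibbsState_conjTranspose_mul_self_nonneg a β)
        (fun h => ha ((hH.re_gibbsState_conjTranspose_mul_self_eq_zero_iff a β).mp h.symm))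
    have hv : 0 < (gibbsState β H (a * aᴴ)).re :=
      lt_of_le_of_ne (hH.re_gibbsState_self_mul_conjTranspose_nonneg a β)
        (fun h => ha ((hH.re_gibbsState_self_mul_conjTranspose_eq_zero_iff a β).mp h.symm))
    have h := hH.eeb_tangent_le β
      (1 + Real.log ((gibbsState β H (aᴴ * a)).re / (gibbsState β H (a * aᴴ)).re)) a
    rwa [tangent_eq_mul_log_div hu hv] at h

/-- **The Gibbs state is a dKMS state for `δ = i[H, ·]`** — the three clauses of Araki–Moriya
Def. 6.3 verbatim, for `⟨·⟩_β = Matrix.gibbsState β H`, every real `β` and every matrix `a`, with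
`δa = i(Ha − aH)`: `(C-1)` `Re⟨aᴴ δa⟩ = 0`; the `+∞`-clause `0 < Re⟨aᴴa⟩ → 0 < Re⟨aaᴴ⟩`; and
`(C-2)` `Re⟨aᴴa⟩ log(Re⟨aᴴa⟩/Re⟨aaᴴ⟩) ≤ β Re(−i⟨aᴴ δa⟩)`. (The abstract predicate is
`State.IsDKMSState`; this is its content for the C⋆-dynamical system `(Matrix n n ℂ, Ad e^{itH})`,
whose generator is `a ↦ i[H,a]` on all of `Matrix n n ℂ`.)
[cite: ArakiMoriya2003, Def 6.3 with Thm 6.4 (finite-dimensional Gibbs state)] -/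
theorem IsHermitian.gibbsState_isDKMS_clauses (hH : H.IsHermitian) (β : ℝ) (a : Matrix n n ℂ) :
    (gibbsState β H (aᴴ * (I • (H * a - a * H)))).re = 0 ∧
    (0 < (gibbsState β H (aᴴ * a)).re → 0 < (gibbsState β H (a * aᴴ)).re) ∧
    (gibbsState β H (aᴴ * a)).re *
        Real.log ((gibbsState β H (aᴴ * a)).re / (gibbsState β H (a * aᴴ)).re) ≤
      β * (-I * gibbsState β H (aᴴ * (I • (H * a - a * H)))).re := by
  have hsm : gibbsState β H (aᴴ * (I • (H * a - a * H))) =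
      I * gibbsState β H (aᴴ * (H * a - a * H)) := by
    rw [Matrix.mul_smul, map_smul, smul_eq_mul]
  refine ⟨?_, fun hu => ?_, ?_⟩
  · rw [hsm, Complex.mul_re, Complex.I_re, Complex.I_im, zero_mul, one_mul, zero_sub,
      hH.im_gibbsState_conjTranspose_mul_commutator, neg_zero]
  · have ha : a ≠ 0 := fun h =>
      hu.ne' ((hH.re_gibbsState_conjTranspose_mul_self_eq_zero_iff a β).mpr h)
    exact lt_of_le_of_ne (hH.re_gibbsState_self_mul_conjTranspose_nonneg a β)
      (fun h => ha ((hH.re_gibbsState_self_mul_conjTranspose_eq_zero_iff a β).mp h.symm))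
  · have hI : -I * gibbsState β H (aᴴ * (I • (H * a - a * H))) =
        gibbsState β H (aᴴ * (H * a - a * H)) := by
      rw [hsm, ← mul_assoc, neg_mul, Complex.I_mul_I, neg_neg, one_mul]
    rw [hI]
    exact hH.eeb_le β a

/-! ### The certificate row form (`eeb-lin` rows of the Hubbard thermal certificates) -/

/-- **EEB certificate row, rational-data form**: for a Hermitian `H`, every real `β`, every matrix
`a` and reals `s`, `R` with `eˢ ≤ R`,
`(1 + s)·Re⟨aᴴa⟩_β − R·Re⟨aaᴴ⟩_β ≤ β·Re⟨aᴴ(Ha − aH)⟩_β`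
— the tangent row `eeb_tangent_le` at `θ = 1 + s` with `e^{θ−1} = eˢ` replaced by any upper bound
`R` (valid because `Re⟨aaᴴ⟩_β ≥ 0`). This is exactly the `eeb-lin` row of the Hubbard-cell thermal
certificate profile (`CERT-THERMAL.md` §0: rationals `s`, `R ≥ eˢ`; there `H` is the torus
Hamiltonian minus `μ N`, an instance of this statement), i.e. the linearised form of
Fawzi–Fawzi–Scalet's constraint (8) with certified rational data.
[cite: FawziFawziScalet2024, arXiv §3.1 Thm 3.1 (5), tangent form with rational majorant R ≥ eˢ] -/
theorem IsHermitian.eeb_row_le_of_exp_le (hH : H.IsHermitian) (β : ℝ) (a : Matrix n n ℂ)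
    {s R : ℝ} (hR : Real.exp s ≤ R) :
    (1 + s) * (gibbsState β H (aᴴ * a)).re - R * (gibbsState β H (a * aᴴ)).re ≤
      β * (gibbsState β H (aᴴ * (H * a - a * H))).re := by
  have h := hH.eeb_tangent_le β (1 + s) a
  rw [add_sub_cancel_left] at h
  have hv := hH.re_gibbsState_self_mul_conjTranspose_nonneg a β
  nlinarith [mul_le_mul_of_nonneg_right hR hv]

/-- **EEB certificate row, `≥ 0` form at positive temperature**: for `β > 0` and `eˢ ≤ R`,
`0 ≤ Re⟨aᴴ(Ha − aH)⟩_β − β⁻¹·((1 + s)·Re⟨aᴴa⟩_β − R·Re⟨aaᴴ⟩_β)` — the row exactly as stored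
(`Re ω(a⋆[H,a]) − β⁻¹[(1+s) Re ω(a⋆a) − R Re ω(aa⋆)] ≥ 0`, `CERT-THERMAL.md` §0).
[cite: FawziFawziScalet2024, arXiv §3.1 Thm 3.1 (5), tangent form with rational majorant R ≥ eˢ] -/
theorem IsHermitian.eeb_row_nonneg_of_exp_le (hH : H.IsHermitian) {β : ℝ} (hβ : 0 < β)
    (a : Matrix n n ℂ) {s R : ℝ} (hR : Real.exp s ≤ R) :
    0 ≤ (gibbsState β H (aᴴ * (H * a - a * H))).re -
      β⁻¹ * ((1 + s) * (gibbsState β H (aᴴ * a)).re - R * (gibbsState β H (a * aᴴ)).re) := by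
  have h := hH.eeb_row_le_of_exp_le β a hR
  rw [sub_nonneg, ← div_eq_inv_mul, div_le_iff₀ hβ]
  calc (1 + s) * (gibbsState β H (aᴴ * a)).re - R * (gibbsState β H (a * aᴴ)).re
      ≤ β * (gibbsState β H (aᴴ * (H * a - a * H))).re := h
    _ = (gibbsState β H (aᴴ * (H * a - a * H))).re * β := mul_comm _ _

end Spectral

end Matrix
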